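/-
Copyright: the b2b-balaban T⁴-continuum CRUX team, row NE7b leaf lineage `t4-ne7b-formalise-leaf-06` (gen 161). Project licence.
-/
import Summits.QuantumFields.BalabanUV.T4Continuum.Spine.NE7b.SupEquationTowerLetters

/-!
# THE TOWER's COMPOSITE TRANSPORT IS THE ONE-SHOT BRANCH OF THE COMPOSITE BLOCKING, AT EVERY LEVEL: whenever the one-shot step
# `(𝒬_k, ℒ_k, P₀ₖ)` — composite blocking, composite lift, a fibre projection reading `ι₀ₖ(P₀ₖ h) = h − ℒ_k(𝒬_k h)` — carries a
# chart `T₀ₖ h = (𝒬_k h, P₀ₖ(Eq₀′(0) h))` with `‖T₀ₖ⁻¹‖ ≤ N₀ₖ` and `C_{P₀ₖ}M_0r_0 ≤ c₀ₖ < N₀ₖ⁻¹`, the `k`-fold transport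
# `Φ_k = σ_0∘⋯∘σ_{k−1}` of `…SupEquationTower.tower_eq` COINCIDES on `closedBall 0 r_k` with the one-shot branch `σ₀ₖ` that
# `…SupInductiveStep.inductiveStep_eq` produces for the composite data — the ℕ-version of leaf-04's
# `…SupEquationTowerSemigroup.twoSteps_eq_oneShot` (`k = 2`) (row NE7b, node U5c; STL ∕ TOWER ∕ SIS BY NAME; [folklore])

Cell `pub-balaban`, sub-cell `t4`, spine estimate NE7b (`T4WeightBudget.RelWeightBound`; the cell's OWN estimate — NOT PRINTED in
[Bałaban 1983–89], NOT PROVED).  Crux-route work under `Spine/NE7b/` by a row leaf (`t4-ne7b-formalise-leaf-06` gen 161) under FREEZE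
(0)'s crux-prover clause (FILING-CLAIM C-ne7bleaf06g161-5; first refusal given to the STG lineage leaf-04 — W-leaf04-g162-2 «GO, NOT MINE», shape CONCUR); NOTHING of Bałaban's is
named as a Lean object, valued or asserted; no `T4Continuum/Support` leaf typed; no `def`; zero `sorry`.  Import: this lineage's
`…SupEquationTowerLetters` (STL; through it TOWER, STEP, SIS).

WHY (located).  Print composes averaging operations and reads ONE background of the composite blocking; the hard-step road walks the
tower one level at a time.  leaf-04's STG shows the two agree after two steps; the agreement at every level is what licenses reading the
tower at any grouping of its steps.  The mechanism is the same and costs no estimate: STL's composite lift `Eq₀(Φ_k w) = ℒ_k(Eq_k w)` with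
`𝒬_k∘ℒ_k = 1` says `Eq₀(Φ_k w)` lies in the range of the composite lift, i.e. `ι₀ₖ(P₀ₖ(Eq₀(Φ_k w))) = 0`, so (`ι₀ₖ` injective at `0`)
`Φ_k w` is CRITICAL for the composite fibre; TOWER (C) gives `Φ_k w ∈ closedBall 0 r_0` and `𝒬_k(Φ_k w) = w`; SIS's uniqueness clause for
the composite data then forces `σ₀ₖ(w) = σ₀ₖ(𝒬_k(Φ_k w)) = Φ_k w`.  The one-shot chart is DISPLAYED, as every chart on this road (for the
free part ASE at the composite side is the candidate — «every side, the same `N_∞`»); its smallness is again the modulus times the radius,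
at level `0`.

WHAT IS PROVED ([folklore]; `X, K : ℕ → Type`, every `X k` a nontrivial real Banach space; `K₀` real normed):
* §1 `compositeFibre_critical_of_letters` — composite lift on `closedBall 0 r_k` + `𝒬_k∘ℒ_k = 1` + fibre reading + `ι₀ₖ` injective at `0`
  ⟹ `P₀ₖ(Eq 0 (Φ k w)) = 0`; `eq_oneShot_of_uniqueness` — SIS's uniqueness clause for `σ₀ₖ` + `Φ k w ∈ closedBall 0 r_0` + `𝒬_k(Φ k w) = w`
  + the criticality ⟹ `Φ k w = σ₀ₖ w`.
* §2 **`tower_eq_oneShot`** — `tower_eq`'s hypotheses VERBATIM, composite lifts `ℒ` with `𝒬_k∘ℒ_k = 1` at the chosen level `k`, and the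
  one-shot data at level `k` (`P₀ₖ, ι₀ₖ, C_{P₀ₖ}, T₀ₖ, N₀ₖ, c₀ₖ` as in the title) ⟹ `∃ σ Eq Eq′ 𝒮 Φ σ₀ₖ`: the tower's recursion equations and
  composite letters, the composite lift, the one-shot branch's SIS (a) letters on `closedBall 0 ((N₀ₖ⁻¹ − c₀ₖ)r_0)` with uniqueness, and
  **`Φ k w = σ₀ₖ w` for every `w ∈ closedBall 0 r_k`**.
* §3 toy (`example`).

NOT HERE (honest): `T₀ₖ`, `N₀ₖ` BY VALUE; any comparison of the two balls — the identification is quantified over `closedBall 0 r_k` (the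
tower's ball at level `k`), the one-shot branch's own letters over `closedBall 0 ((N₀ₖ⁻¹ − c₀ₖ)r_0)`, and `r_k` vs `(N₀ₖ⁻¹ − c₀ₖ)r_0` is NOT
compared (numbers, (A3); SIS's uniqueness clause needs only `x ∈ closedBall 0 r_0`, which TOWER (C) supplies — leaf-04's located remark); the `ℓ^∞`
instance; NC-NE7b-α UNRULED; anything of Bałaban's.  BY-NAME EFFECT ON THE WALL: NONE.  NE7b NOT PRINTED ∕ NOT PROVED; spine PROVED 0∕9;
rung (B)+1 on a FINITE torus — NOT infinite volume, NOT the mass gap, NOT Clay.  HONEST DEPENDENCY: continuum YM on T⁴ ⇐ BetaPertH ∧ nine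
spine estimates (0∕9 proved); BetaPertH ⇐ (D1) ∧ (D4) ∧ CAP+tail; G-an2-4 gates asym, D1 and NE2∕3∕4.
-/

set_option autoImplicit false

noncomputable section

namespace Summit.QuantumFields.BalabanUV.T4Continuum.NE7b.SupEquationTowerOneShot

open Set Metric Function
open scoped NNReal
open Summit.QuantumFields.BalabanUV.T4Continuum.NE7b

variable {X : ℕ → Type*} {K : ℕ → Type*} [∀ k, NormedAddCommGroup (X k)] [∀ k, NormedSpace ℝ (X k)]
  [∀ k, NormedAddCommGroup (K k)] [∀ k, NormedSpace ℝ (K k)]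
  {K₀ : Type*} [NormedAddCommGroup K₀] [NormedSpace ℝ K₀]

/-! ## §1. Two letters -/

/-- The transported background is CRITICAL FOR THE COMPOSITE FIBRE: composite lift + `𝒬_k∘ℒ_k = 1` + the fibre reading + `ι₀ₖ`
injective at `0` give `P₀ₖ(Eq 0 (Φ k w)) = 0` on `closedBall 0 r_k`. [folklore] -/
theorem compositeFibre_critical_of_letters {k : ℕ} (Eq : ∀ j, X j → X j) (Φ : ∀ j, X j → X 0) (ℒ : ∀ j, X j →L[ℝ] X 0)
    (𝒬 : ∀ j, X 0 →L[ℝ] X j) (h𝒬ℒ : (𝒬 k).comp (ℒ k) = ContinuousLinearMap.id ℝ (X k))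
    (P₀ : X 0 →L[ℝ] K₀) (ι₀ : K₀ →L[ℝ] X 0) (hPι₀ : ∀ h, ι₀ (P₀ h) = h - ℒ k (𝒬 k h)) (hι₀ : ∀ κ, ι₀ κ = 0 → κ = 0)
    {r : ℕ → ℝ} (hcl : ∀ w ∈ closedBall (0 : X k) (r k), Eq 0 (Φ k w) = ℒ k (Eq k w))
    {w : X k} (hw : w ∈ closedBall (0 : X k) (r k)) : P₀ (Eq 0 (Φ k w)) = 0 := by
  apply hι₀
  have e : 𝒬 k (ℒ k (Eq k w)) = Eq k w := by
    simpa using congrArg (fun L : X k →L[ℝ] X k => L (Eq k w)) h𝒬ℒ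
  rw [hPι₀, hcl w hw, e, sub_self]

/-- SIS's uniqueness clause identifies the transported background with the one-shot branch: `Φ k w = σ₀ₖ w`. [folklore] -/
theorem eq_oneShot_of_uniqueness {k : ℕ} (Eq : ∀ j, X j → X j) (Φ : ∀ j, X j → X 0) (𝒬 : ∀ j, X 0 →L[ℝ] X j) (P₀ : X 0 →L[ℝ] K₀)
    {σ₀ : X k → X 0} {r : ℕ → ℝ}
    (huniq : ∀ x ∈ closedBall (0 : X 0) (r 0), P₀ (Eq 0 x) = 0 → σ₀ (𝒬 k x) = x)
    {w : X k} (hmem : Φ k w ∈ closedBall (0 : X 0) (r 0)) (hsec : 𝒬 k (Φ k w) = w) (hcrit : P₀ (Eq 0 (Φ k w)) = 0) :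
    Φ k w = σ₀ w := by
  have h := huniq (Φ k w) hmem hcrit
  rw [hsec] at h
  exact h.symm

/-! ## §2. The identification on the tower -/

/-- **THE TOWER's COMPOSITE TRANSPORT IS THE ONE-SHOT BRANCH**: `tower_eq`'s hypotheses, composite lifts `ℒ` with `𝒬_k∘ℒ_k = 1`, and the
one-shot data of the composite blocking at level `k` ⟹ the tower's families, the one-shot branch `σ₀ₖ` with SIS's (a) letters and
uniqueness, and `Φ k w = σ₀ₖ w` on `closedBall 0 r_k`. [folklore] -/
theorem tower_eq_oneShot [∀ j, CompleteSpace (X j)] [∀ j, Nontrivial (X j)]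
    (Q : ∀ j, X j →L[ℝ] X (j + 1)) (Lp : ∀ j, X (j + 1) →L[ℝ] X j) (P : ∀ j, X j →L[ℝ] K j) (ι : ∀ j, K j →L[ℝ] X j)
    (hPι : ∀ j h, ι j (P j h) = h - Lp j (Q j h)) {CP : ℕ → ℝ} (hCP : ∀ j, ‖P j‖ ≤ CP j)
    (𝒬 : ∀ j, X 0 →L[ℝ] X j) (h𝒬0 : 𝒬 0 = ContinuousLinearMap.id ℝ (X 0)) (h𝒬 : ∀ j, 𝒬 (j + 1) = (Q j).comp (𝒬 j))
    (ℒ : ∀ j, X j →L[ℝ] X 0) (hℒ0 : ℒ 0 = ContinuousLinearMap.id ℝ (X 0)) (hℒ : ∀ j, ℒ (j + 1) = (ℒ j).comp (Lp j))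
    {Eq₀ : X 0 → X 0} {Eq₀' : X 0 → X 0 →L[ℝ] X 0} (hE0 : Eq₀ 0 = 0)
    {r B M : ℕ → ℝ} (hr0 : ∀ j, 0 ≤ r j) (hM0 : ∀ j, 0 ≤ M j)
    (hE : ∀ x ∈ closedBall (0 : X 0) (r 0), HasFDerivAt Eq₀ (Eq₀' x) x)
    (hB : ∀ x ∈ closedBall (0 : X 0) (r 0), ‖Eq₀' x‖ ≤ B 0)
    (hM : ∀ x ∈ closedBall (0 : X 0) (r 0), ∀ x' ∈ closedBall (0 : X 0) (r 0), ‖Eq₀' x - Eq₀' x'‖ ≤ M 0 * ‖x - x'‖)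
    (T : ∀ j, X j ≃L[ℝ] X (j + 1) × K j) {N c : ℕ → ℝ≥0}
    (hT : ∀ j (𝒮 : X j →L[ℝ] X 0), (𝒬 j).comp 𝒮 = ContinuousLinearMap.id ℝ (X j) →
      (∀ i, i < j → ∀ h, P i (𝒬 i (Eq₀' 0 (𝒮 h))) = 0) → ∀ h, T j h = (Q j h, P j (𝒬 j (Eq₀' 0 (𝒮 h)))))
    (hN : ∀ j (y : X (j + 1) × K j), ‖(T j).symm y‖ ≤ N j * ‖y‖) (hcN : ∀ j, c j < (N j)⁻¹)
    (hc : ∀ j, CP j * M j * r j ≤ (c j : ℝ)) (hr : ∀ j, r (j + 1) < ((N j : ℝ)⁻¹ - c j) * r j)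
    (hBs : ∀ j, ‖Q j‖ * B j * ((N j : ℝ)⁻¹ - c j)⁻¹ ≤ B (j + 1))
    (hMs : ∀ j, ‖Q j‖ * (M j * ((N j : ℝ)⁻¹ - c j)⁻¹ * ((N j : ℝ)⁻¹ - c j)⁻¹ +
      B j * ((((N j : ℝ)⁻¹ - c j)⁻¹) ^ 2 * (CP j * M j) * ((N j : ℝ)⁻¹ - c j)⁻¹)) ≤ M (j + 1))
    -- the one-shot data of the composite blocking at level `k`
    (k : ℕ) (h𝒬ℒ : (𝒬 k).comp (ℒ k) = ContinuousLinearMap.id ℝ (X k))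
    (P₀ : X 0 →L[ℝ] K₀) (ι₀ : K₀ →L[ℝ] X 0) (hPι₀ : ∀ h, ι₀ (P₀ h) = h - ℒ k (𝒬 k h)) (hι₀ : ∀ κ, ι₀ κ = 0 → κ = 0)
    {CP₀ : ℝ} (hCP₀ : ‖P₀‖ ≤ CP₀) (T₀ : X 0 ≃L[ℝ] X k × K₀) (hT₀ : ∀ h, T₀ h = (𝒬 k h, P₀ (Eq₀' 0 h))) {N₀ c₀ : ℝ≥0}
    (hN₀ : ∀ y : X k × K₀, ‖T₀.symm y‖ ≤ N₀ * ‖y‖) (hcN₀ : c₀ < N₀⁻¹) (hc₀ : CP₀ * M 0 * r 0 ≤ (c₀ : ℝ)) :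
    ∃ (σ : ∀ j, X (j + 1) → X j) (Eq : ∀ j, X j → X j) (Eq' : ∀ j, X j → X j →L[ℝ] X j) (𝒮 : ∀ j, X j →L[ℝ] X 0)
      (Φ : ∀ j, X j → X 0) (σ₀ : X k → X 0),
      -- the tower's recursion equations, composite letters and composite lift
      Eq 0 = Eq₀ ∧ Eq' 0 = Eq₀' ∧ Φ 0 = id ∧ (∀ j, Eq (j + 1) = fun w => Q j (Eq j (σ j w))) ∧
      (∀ j, Eq' (j + 1) = fun w => (Q j).comp ((Eq' j (σ j w)).comp (fderiv ℝ (σ j) w))) ∧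
      (∀ j, Φ (j + 1) = Φ j ∘ σ j) ∧ (∀ j, 𝒮 (j + 1) = (𝒮 j).comp (fderiv ℝ (σ j) 0)) ∧
      (∀ j, Φ j 0 = 0 ∧ (∀ w ∈ closedBall (0 : X j) (r j), Φ j w ∈ closedBall (0 : X 0) (r 0)) ∧
        (∀ w ∈ closedBall (0 : X j) (r j), 𝒬 j (Φ j w) = w) ∧
        LipschitzOnWith (∏ i ∈ Finset.range j, ((N i)⁻¹ - c i)⁻¹) (Φ j) (closedBall (0 : X j) (r j)) ∧
        (∀ w ∈ closedBall (0 : X j) (r j), Eq j w = 0 → Eq₀ (Φ j w) = 0)) ∧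
      (∀ j, ∀ w ∈ closedBall (0 : X j) (r j), Eq₀ (Φ j w) = ℒ j (Eq j w)) ∧
      (∀ j, HasFDerivAt (Φ j) (𝒮 j) 0) ∧
      -- the one-shot branch of the composite blocking at level `k`
      σ₀ 0 = 0 ∧
      (∀ v ∈ closedBall (0 : X k) (((N₀ : ℝ)⁻¹ - c₀) * r 0),
        σ₀ v ∈ closedBall (0 : X 0) (r 0) ∧ 𝒬 k (σ₀ v) = v ∧ P₀ (Eq₀ (σ₀ v)) = 0 ∧ Eq₀ (σ₀ v) = ℒ k (𝒬 k (Eq₀ (σ₀ v)))) ∧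
      LipschitzOnWith (N₀⁻¹ - c₀)⁻¹ σ₀ (closedBall (0 : X k) (((N₀ : ℝ)⁻¹ - c₀) * r 0)) ∧
      (∀ x ∈ closedBall (0 : X 0) (r 0), P₀ (Eq₀ x) = 0 → σ₀ (𝒬 k x) = x) ∧
      -- THE IDENTIFICATION
      (∀ w ∈ closedBall (0 : X k) (r k), Φ k w = σ₀ w) := by
  obtain ⟨σ, Eq, Eq', 𝒮, Φ, hEq0, hEq'0, -, hΦ0, hEs, hE's, h𝒮s, hΦs, hC, hcl, hD⟩ :=
    SupEquationTowerLetters.tower_eq_compositeLetters Q Lp P ι hPι hCP 𝒬 h𝒬0 h𝒬 ℒ hℒ0 hℒ hE0 hr0 hM0 hE hB hM T hT hN hcN hc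
      hr hBs hMs
  -- the one-shot step: SIS at the composite level, smallness = modulus × radius at level `0`
  have hck : ∀ x ∈ closedBall (0 : X 0) (r 0), ‖P₀.comp (Eq₀' x - Eq₀' 0)‖ ≤ c₀ := fun x hx =>
    (SupEquationTowerStep.norm_comp_sub_le_of_modulus_closedBall P₀ hCP₀ (hM0 0) (hr0 0) hM hx).trans hc₀
  obtain ⟨σ₀, h00, h0a, h0lip, h0uniq, -⟩ :=
    SupInductiveStep.inductiveStep_eq (𝒬 k) (ℒ k) P₀ ι₀ hPι₀ hCP₀ hE0 (hr0 0) hE hB (hM0 0) hM (Eq₀' 0) T₀ hT₀ hN₀ hcN₀ hck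
  refine ⟨σ, Eq, Eq', 𝒮, Φ, σ₀, hEq0, hEq'0, hΦ0, hEs, hE's, hΦs, h𝒮s, hC, hcl, hD, h00, h0a, h0lip, h0uniq, fun w hw => ?_⟩
  obtain ⟨-, hmem, hsec, -, -⟩ := hC k
  have hcl' : ∀ w ∈ closedBall (0 : X k) (r k), Eq 0 (Φ k w) = ℒ k (Eq k w) := fun w hw => by rw [hEq0]; exact hcl k w hw
  have hcrit := compositeFibre_critical_of_letters Eq Φ ℒ 𝒬 h𝒬ℒ P₀ ι₀ hPι₀ hι₀ hcl' hw
  have huniq' : ∀ x ∈ closedBall (0 : X 0) (r 0), P₀ (Eq 0 x) = 0 → σ₀ (𝒬 k x) = x := by rw [hEq0]; exact h0uniq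
  exact eq_oneShot_of_uniqueness Eq Φ 𝒬 P₀ huniq' (hmem w hw) (hsec w hw) hcrit

/-! ## §3. Toy -/

/-- Toy: the uniqueness mechanism on `ℝ` — if `σ₀(q x) = x` for every critical `x` and `Φ w` is critical with `q(Φ w) = w`, then
`Φ w = σ₀ w`. -/
example (Φ σ₀ q : ℝ → ℝ) (crit : ℝ → Prop) (huniq : ∀ x, crit x → σ₀ (q x) = x) (w : ℝ) (hc : crit (Φ w)) (hq : q (Φ w) = w) :
    Φ w = σ₀ w := by
  have h := huniq (Φ w) hc
  rw [hq] at h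
  exact h.symm

end Summit.QuantumFields.BalabanUV.T4Continuum.NE7b.SupEquationTowerOneShot

end
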